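import Summits.AtomisticToContinuum.Crystallization.Theses.PricedLinkCensus
import Summits.AtomisticToContinuum.Crystallization.Theorems.PricedLinkCensusChargeFreeWindows
import Summits.AtomisticToContinuum.Crystallization.Theorems.PricedLinkCensusStackingHinge
import Literature.MathematicalPhysics.StatisticalMechanics.LennardJonesClusters

/-!
# Disproof of `StackingHinge` (crux stmt-AtomisticToContinuum-14993, route PricedLinkCensus) — findings

Standing disprover's work file (refuter-cdisprove-stmt-AtomisticToContinuum-14993-0, cycle 1, v1.5).
Prose lives in docstrings only; everything not marked `sorry` is checked (`lean check` rc 0).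
LANDED from this file: `Theorems/StackingHinge/Negative/ScaleSelection.lean` (p99020 ACCEPTED; §1–§2
below verbatim, namespace `Summit.AtomisticToContinuum.Crystallization.Theorems.StackingHingeNegative` —
provers should import THAT module; this work file keeps its self-contained copies until the farm has
built the new module, then switches to importing it).  READY TO LAND (attached as item evidence
`Negative/Recurrence.lean`, checked): §3a below, target `Theorems/StackingHinge/Negative/Recurrence.lean`.

`StackingHinge` is `SoftLayerPropagation → ChargeFreeWindows → GroundStatesChargePeriodic` (the two
antecedents and the consequent written out verbatim).  VERDICT OF CYCLE 1: **no kill, and no kill is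
available to any cheap method** — see §1: the negation of the crux is EQUIVALENT to
`SoftLayerPropagation ∧ ZeroChargeBulk ∧ ¬ GroundStatesChargePeriodic`, i.e. an unconditional
refutation must PROVE two open items of the route (the crux `SoftLayerPropagation`, 14233, and the
route's TARGET `ZeroChargeBulk`, 14229, through the in-tree `chargeFreeWindows_iff_zeroChargeBulk`)
and DISPROVE the shared hinge 2911 for Lennard-Jones ground states.  The crux is conjecture-grade and
physically expected to hold (hcp strict minimality among stackings, numerics j015373 of ideator 2:
letter price `γ_eff ≥ 7.25e-5` per c-layer site, relaxation gain `≤ 5.2e-9`).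

What the file DOES establish, for the provers (lead line `Sketch`):

* §1 STRUCTURE. `not_stackingHinge_iff`; the two vacuity channels
  (`stackingHinge_of_not_softLayerPropagation`, `stackingHinge_of_not_zeroChargeBulk`): a refutation of
  either antecedent crux closes THIS crux trivially (and breaks the route elsewhere).  The standing
  disprover of `SoftLayerPropagation` reports that SLP survives with margins (tolerance lower bound
  `1/20 < 1/6`, radius lower bound `2.8 < 8`; `Cruxes/SoftLayerPropagation/Disproof.lean` §5–§6), so
  channel 1 is not expected to open.
* §2 SCALE IS LOAD-BEARING (LANDED: `Theorems/StackingHinge/Negative/ScaleSelection.lean`, p99020).  Both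
  antecedents and `IsChargeFree` are invariant under an INDEPENDENT rescaling `x N ↦ c_N • x N` of every
  member of the sequence (`windowBadCard_smul`), while the consequent pins an absolute length (the
  period lattice of `Q`, compared through a LINEAR ISOMETRY at tolerance `ε`): `ChargesPeriodic` fails
  for every sequence whose `N`-th member is `N`-separated (`not_chargesPeriodic_of_sparse`), and every
  injective sequence has such a rescaling (`exists_rescaling_not_chargesPeriodic`).  Hence the hinge
  with the class "Lennard-Jones ground states" replaced by any class closed under per-`N` rescaling and
  containing one injective sequence with charge-free windows a.e. is FALSE
  (`hingeOver_rescalings_false`); granted the route's own target `ZeroChargeBulk`, the class of rescaled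
  ground-state sequences is such a class (`stackingHinge_false_without_scale`).  Reading: step (c) of
  the planner's plan ("the common scale `nn_i → a*`") is not bookkeeping — any proof must use a
  property of `IsGroundState lennardJones` that is not scale-invariant (in tree: the uniform bounds
  `nn_i ∈ [δ, D]`, `LennardJonesMinimalDistance_holds` and the `D` of `layeringGlue_proof`); the line
  `Sketch` does this correctly by pricing at the absolute scale `(a, h)` against `E_LJ`.
* §3 WORD SELECTION IS LOAD-BEARING.  §3a (checked; evidence `Negative/Recurrence.lean`): the consequent
  has a `Q`-free NECESSARY condition — ONE basis of `ℝ³` recurs, up to a site-dependent rotation, as a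
  triple of approximate periods in a positive density of windows at every `(R, ε)`
  (`exists_basis_recurrent_of_chargesPeriodic`), with the contrapositive KILL CRITERIA
  `not_chargesPeriodic_of_not_recurrent`, `not_groundStatesChargePeriodic_of_not_recurrent`,
  `stackingHinge_false_of_not_recurrent` (one non-recurrent ground-state sequence refutes 2911, and
  with the two antecedents the crux).  §3b (near-miss, `sorry`, paper proof in the docstring): even EXACT
  Barlow windows almost everywhere at a FIXED scale do not charge a periodic `Q` — balls of a
  Sturmian-stacked close packing (4-power-free Hägg word) are the witness; a periodic `Q` matching
  windows of radius `R` forces an `m`-periodic factor of length `∼ 2R/h`, `0 < m ≤ C(Q)/h`.  The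
  in-tree König/compactness selection (`exists_branch_frequently_mul_le`,
  `exists_chargedWordScale_of_chargedBarlowWindows`) indeed only yields SOME word, possibly aperiodic;
  periodicity must come from energy (Hägg domination, the `κ·#U` column of `stub_pricedHcpWindows`).
  Remark (strain): slowly varying strain does NOT defeat the consequent, because `ρ` may shrink with
  `(R, ε)` — a one-parameter family of homogeneous strains leaves a fraction `∼ ε/(αR) > 0` of sites
  matched to each member; only structure varying at a FIXED wavelength everywhere defeats it.  So
  residual (a) "strain → 0" is needed only in the weak form "strain gradients → 0 in density".
* §4 LINE `Sketch` (targets: none registered; stuck stubs: none).  Stub-by-stub: the word column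
  `stub_sitewiseEvenAlignmentDomination` is TRUE (alignment sets of a Hägg word contain no two
  consecutive integers, `j`-th element `≥ 2j`, resp. `≥ 2j+1` when `2 ∉ A`; monotone non-positive
  couplings); the squeeze `stub_hcpCharged_of_priced` is sound bookkeeping (ground states injective and
  `δ`-separated, `E(N)/N → e*` proved, `#B = o(N)` is `ChargeFreeWindows` at radius `L`); the priced
  inequality `stub_pricedHcpWindows` can only fail through a family with `(E − N e*)/#U → 0` AND
  `#B/#U → 0` (`pricedHcpWindows_kill_shape`, §4), i.e. near-degenerate CHARGE-FREE competitors of hcp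
  at every `(R, ε)`: stacking variants cost `≥ 7.25e-5·f_c` (j015373), homogeneous strain `t ≥ ε/R`
  costs `∼ ½B t²`, vacancies/voids are charged (paid by `−C·#B`, which forces the prover's `L ≳ R` and
  `C ≳ κ R³`), rescaled copies cost `N(e(ta*) − e*)`.  No misstatement found; the stub is exactly as
  hard as "relaxed hcp is the strict, coercive minimiser of `e_LJ` inside the 1 %-charge-free class".
-/

noncomputable section

namespace Summit.AtomisticToContinuum.Crystallization.Cruxes.StackingHinge.Disproof

open Summit.AtomisticToContinuum.Crystallization.Theses.PricedLinkCensus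
open Summit.AtomisticToContinuum.Crystallization.Theorems
open Literature.MathematicalPhysics.StatisticalMechanics Literature.Geometry.DiscreteGeometry
open Filter Topology

/-- Euclidean `3`-space. -/
local notation "E3" => EuclideanSpace ℝ (Fin 3)

/-! ## §1 Structure of the crux: what a refutation would have to contain -/

/-- The crux unfolded: `SoftLayerPropagation → ChargeFreeWindows → GroundStatesChargePeriodic`
(all three are route decls; the antecedent and consequent are inlined verbatim in the crux). -/
theorem stackingHinge_iff :
    StackingHinge ↔ (SoftLayerPropagation → ChargeFreeWindows → GroundStatesChargePeriodic) :=
  Iff.rfl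

/-- **What a kill must contain.**  `¬ StackingHinge` is equivalent to: soft layer propagation holds
(crux 14233), the route TARGET `ZeroChargeBulk` holds (14229; `ChargeFreeWindows ↔ ZeroChargeBulk` is
the in-tree `chargeFreeWindows_iff_zeroChargeBulk`), and the shared hinge 2911 FAILS.  So the crux is
false only in a world where Lennard-Jones ground states ARE asymptotically charge-free (locally
Barlow at `1 %`) and yet charge no periodic configuration — persistent stacking disorder, strain at a
fixed wavelength, or no common scale, along actual ground states. -/
theorem not_stackingHinge_iff :
    ¬ StackingHinge ↔ SoftLayerPropagation ∧ ZeroChargeBulk ∧ ¬ GroundStatesChargePeriodic := by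
  rw [stackingHinge_iff, chargeFreeWindows_iff_zeroChargeBulk]
  tauto

/-- Vacuity channel 1: a refutation of the crux `SoftLayerPropagation` proves this crux. -/
theorem stackingHinge_of_not_softLayerPropagation (h : ¬ SoftLayerPropagation) : StackingHinge :=
  fun hSLP => absurd hSLP h

/-- Vacuity channel 2: a refutation of the route target `ZeroChargeBulk` proves this crux. -/
theorem stackingHinge_of_not_zeroChargeBulk (h : ¬ ZeroChargeBulk) : StackingHinge :=
  fun _ hW => absurd (chargeFreeWindows_iff_zeroChargeBulk.1 hW) h

/-! ## §2 Scale is load-bearing: the hinge over rescaling-closed classes is false -/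

/-- The consequent of the hinge for ONE sequence `x`: some periodic `Q` is charged with positive
upper density at every window `(R, ε)` (verbatim the body of `GroundStatesChargePeriodic`). -/
def ChargesPeriodic (x : (N : ℕ) → (Fin N → E3)) : Prop :=
  ∃ Q : PeriodicConfiguration 3, ∀ R ε : ℝ, 0 < R → 0 < ε → ∃ ρ : ℝ, 0 < ρ ∧
    ∃ᶠ N : ℕ in atTop, ρ * (N : ℝ) ≤ (Nat.card {i : Fin N // ∃ A : E3 →ₗᵢ[ℝ] E3, ∃ q ∈ Q.points,
      (∀ s ∈ Q.points, dist s q ≤ R → ∃ j : Fin N, dist (x N j) (x N i + A (s - q)) ≤ ε) ∧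
      (∀ j : Fin N, dist (x N j) (x N i) ≤ R →
        ∃ s ∈ Q.points, dist (x N j) (x N i + A (s - q)) ≤ ε)} : ℝ)

/-- `GroundStatesChargePeriodic` is `ChargesPeriodic` along every sequence of ground states. -/
theorem groundStatesChargePeriodic_iff :
    GroundStatesChargePeriodic ↔ ∀ x : (N : ℕ) → (Fin N → E3),
      (∀ N, IsGroundState lennardJones (x N)) → ChargesPeriodic x :=
  Iff.rfl

/-- The size of the exceptional set of `ChargeFreeWindows` at radius `R` for one configuration:
sites `i` having a site within `R · nn_i` that is not charge-free at `1/100`. -/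
def windowBadCard (R : ℝ) {N : ℕ} (y : Fin N → E3) : ℕ :=
  Nat.card {i : Fin N // ¬ ∀ j : Fin N, dist (y i) (y j) ≤ R * nearestDist y i →
    IsChargeFree (1 / 100 : ℝ) y j}

/-- Charge-free windows almost everywhere along ONE sequence. -/
def WindowsAE (x : (N : ℕ) → (Fin N → E3)) : Prop :=
  ∀ R : ℝ, 0 < R → Tendsto (fun N : ℕ => (windowBadCard R (x N) : ℝ) / N) atTop (𝓝 0)

/-- The hinge with the class of Lennard-Jones ground-state sequences replaced by an arbitrary class
`𝒞` of sequences of finite configurations. -/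
def HingeOver (𝒞 : ((N : ℕ) → (Fin N → E3)) → Prop) : Prop :=
  SoftLayerPropagation →
    (∀ R : ℝ, 0 < R → ∀ x : (N : ℕ) → (Fin N → E3), 𝒞 x →
      Tendsto (fun N : ℕ => (windowBadCard R (x N) : ℝ) / N) atTop (𝓝 0)) →
    ∀ x : (N : ℕ) → (Fin N → E3), 𝒞 x → ChargesPeriodic x

/-- The crux is the hinge over the class of Lennard-Jones ground-state sequences (definitionally). -/
theorem stackingHinge_iff_hingeOver :
    StackingHinge ↔ HingeOver (fun x => ∀ N, IsGroundState lennardJones (x N)) :=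
  Iff.rfl

/-- **Rescaling invariance of the antecedent.**  The exceptional set of `ChargeFreeWindows` is
unchanged by `y ↦ c • y` (`c ≠ 0`): distances and nearest-neighbour distances scale by `‖c‖` and
charge-freeness is scale-invariant (`isChargeFree_smul_iff`). -/
theorem windowBadCard_smul {c : ℝ} (hc : c ≠ 0) (R : ℝ) {N : ℕ} (y : Fin N → E3) :
    windowBadCard R (c • y) = windowBadCard R y := by
  unfold windowBadCard
  refine Nat.card_congr (Equiv.subtypeEquivRight fun i => ?_)
  have hc' : 0 < ‖c‖ := norm_pos_iff.2 hc
  simp only [Pi.smul_apply, dist_smul₀, nearestDist_smul, isChargeFree_smul_iff hc]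
  refine not_congr (forall_congr' fun j => ?_)
  rw [mul_left_comm, mul_le_mul_iff_right₀ hc']

/-- A full-rank lattice in `ℝ³` has a non-zero vector. -/
theorem exists_mem_lattice_ne_zero (Q : PeriodicConfiguration 3) : ∃ g ∈ Q.lattice, g ≠ 0 := by
  by_contra h
  push Not at h
  have hsub : (Q.lattice : Set E3) ⊆ {(0 : E3)} := fun g hg => h g hg
  have h1 : Submodule.span ℝ (Q.lattice : Set E3) ≤ Submodule.span ℝ {(0 : E3)} :=
    Submodule.span_mono hsub
  rw [Q.isZLattice.span_top, Submodule.span_zero_singleton] at h1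
  have hmem : (EuclideanSpace.single (0 : Fin 3) (1 : ℝ) : E3) ∈ (⊥ : Submodule ℝ E3) :=
    h1 Submodule.mem_top
  rw [Submodule.mem_bot] at hmem
  have := congrArg (fun v : E3 => v 0) hmem
  simp at this

/-- **The consequent is not scale-free.**  If the `N`-th configuration is `N`-separated
(`dist (x N i) (x N j) ≥ N` for `i ≠ j`), then NO periodic `Q` is charged: take a non-zero period
`g` of `Q`, the window `R = ‖g‖`, `ε = ‖g‖/4`; a good site `i` (there is one, the good set having
positive density for infinitely many `N`) must see a site `ε`-close to `x N i + A g`, which is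
neither `i` itself (`‖A g‖ = ‖g‖ > ε`) nor another site (those are `≥ N > ‖g‖ + ε` away). -/
theorem not_chargesPeriodic_of_sparse (x : (N : ℕ) → (Fin N → E3))
    (hx : ∀ (N : ℕ) (i j : Fin N), i ≠ j → (N : ℝ) ≤ dist (x N i) (x N j)) :
    ¬ ChargesPeriodic x := by
  rintro ⟨Q, hQ⟩
  obtain ⟨g, hg, hg0⟩ := exists_mem_lattice_ne_zero Q
  have hR : 0 < ‖g‖ := norm_pos_iff.2 hg0
  obtain ⟨ρ, hρ, hfr⟩ := hQ ‖g‖ (‖g‖ / 4) hR (by positivity)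
  obtain ⟨N, hgood, hN⟩ := (hfr.and_eventually (eventually_gt_atTop ⌈2 * ‖g‖⌉₊)).exists
  have hN' : 2 * ‖g‖ < N := (Nat.le_ceil _).trans_lt (by exact_mod_cast hN)
  have hNpos : (0 : ℝ) < N := by linarith
  have hpos : 0 < Nat.card {i : Fin N // ∃ A : E3 →ₗᵢ[ℝ] E3, ∃ q ∈ Q.points,
      (∀ s ∈ Q.points, dist s q ≤ ‖g‖ → ∃ j : Fin N, dist (x N j) (x N i + A (s - q)) ≤ ‖g‖ / 4) ∧
      (∀ j : Fin N, dist (x N j) (x N i) ≤ ‖g‖ →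
        ∃ s ∈ Q.points, dist (x N j) (x N i + A (s - q)) ≤ ‖g‖ / 4)} := by
    have : (0 : ℝ) < Nat.card _ := (mul_pos hρ hNpos).trans_le hgood
    exact_mod_cast this
  obtain ⟨⟨i, A, q, hq, h1, -⟩⟩ := (Nat.card_pos_iff.1 hpos).1
  obtain ⟨j, hj⟩ := h1 (q + g) (Q.add_mem_points hq hg)
    (by rw [dist_eq_norm, add_sub_cancel_left])
  rw [add_sub_cancel_left] at hj
  have hAg : ‖A g‖ = ‖g‖ := A.norm_map g
  by_cases hji : j = i
  · subst hji
    rw [dist_comm, dist_eq_norm, add_sub_cancel_left, hAg] at hj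
    linarith
  · have h3 := hx N j i hji
    have h4 : dist (x N j) (x N i) ≤ dist (x N j) (x N i + A g) + dist (x N i + A g) (x N i) :=
      dist_triangle _ _ _
    rw [dist_eq_norm (x N i + A g), add_sub_cancel_left, hAg] at h4
    linarith

/-- A finite injective configuration has a positive minimal distance. -/
theorem exists_pos_le_dist {N : ℕ} {y : Fin N → E3} (hy : Function.Injective y) :
    ∃ m : ℝ, 0 < m ∧ ∀ i j : Fin N, i ≠ j → m ≤ dist (y i) (y j) := by
  classical
  let S : Finset ℝ := (Finset.univ.filter fun p : Fin N × Fin N => p.1 ≠ p.2).image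
    fun p => dist (y p.1) (y p.2)
  have hmem : ∀ i j : Fin N, i ≠ j → dist (y i) (y j) ∈ S := fun i j hij =>
    Finset.mem_image.2 ⟨(i, j), Finset.mem_filter.2 ⟨Finset.mem_univ _, hij⟩, rfl⟩
  by_cases hne : S.Nonempty
  · refine ⟨S.min' hne, ?_, fun i j hij => S.min'_le _ (hmem i j hij)⟩
    obtain ⟨p, hp, hpeq⟩ := Finset.mem_image.1 (S.min'_mem hne)
    rw [← hpeq]
    exact dist_pos.2 (hy.ne (Finset.mem_filter.1 hp).2)
  · exact ⟨1, one_pos, fun i j hij => absurd ⟨_, hmem i j hij⟩ hne⟩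

/-- **Every injective sequence has a rescaling that charges no periodic configuration**: blow the
`N`-th member up until it is `N`-separated. -/
theorem exists_rescaling_not_chargesPeriodic (x : (N : ℕ) → (Fin N → E3))
    (hx : ∀ N, Function.Injective (x N)) :
    ∃ c : ℕ → ℝ, (∀ N, 0 < c N) ∧ ¬ ChargesPeriodic (fun N => c N • x N) := by
  choose m hm hmle using fun N => exists_pos_le_dist (hx N)
  refine ⟨fun N => N / m N + 1, fun N => by have := hm N; positivity,
    not_chargesPeriodic_of_sparse _ fun N i j hij => ?_⟩
  show (N : ℝ) ≤ dist ((N / m N + 1) • x N i) ((N / m N + 1) • x N j)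
  have hc : (0 : ℝ) ≤ N / m N + 1 := by have := hm N; positivity
  rw [dist_smul₀, Real.norm_of_nonneg hc]
  calc (N : ℝ) ≤ N + m N := le_add_of_nonneg_right (hm N).le
    _ = (N / m N + 1) * m N := by rw [add_mul, div_mul_cancel₀ _ (hm N).ne', one_mul]
    _ ≤ (N / m N + 1) * dist (x N i) (x N j) := mul_le_mul_of_nonneg_left (hmle N i j hij) hc

/-- The class of per-`N` rescalings of a fixed sequence `x₀`. -/
def Rescalings (x₀ : (N : ℕ) → (Fin N → E3)) (x : (N : ℕ) → (Fin N → E3)) : Prop :=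
  ∃ c : ℕ → ℝ, (∀ N, 0 < c N) ∧ x = fun N => c N • x₀ N

/-- `x₀` is a rescaling of itself. -/
theorem rescalings_self (x₀ : (N : ℕ) → (Fin N → E3)) : Rescalings x₀ x₀ :=
  ⟨fun _ => 1, fun _ => one_pos, by funext N; rw [one_smul]⟩

/-- The antecedent passes to the whole rescaling class. -/
theorem windows_of_rescalings {x₀ : (N : ℕ) → (Fin N → E3)} (hW : WindowsAE x₀) :
    ∀ R : ℝ, 0 < R → ∀ x : (N : ℕ) → (Fin N → E3), Rescalings x₀ x →
      Tendsto (fun N : ℕ => (windowBadCard R (x N) : ℝ) / N) atTop (𝓝 0) := by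
  rintro R hR x ⟨c, hc, rfl⟩
  have : (fun N : ℕ => (windowBadCard R (c N • x₀ N) : ℝ) / N) =
      fun N : ℕ => (windowBadCard R (x₀ N) : ℝ) / N :=
    funext fun N => by rw [windowBadCard_smul (hc N).ne']
  rw [this]
  exact hW R hR

/-- The consequent fails somewhere in the rescaling class of any injective sequence. -/
theorem not_forall_rescalings_chargesPeriodic {x₀ : (N : ℕ) → (Fin N → E3)}
    (hinj : ∀ N, Function.Injective (x₀ N)) :
    ¬ ∀ x : (N : ℕ) → (Fin N → E3), Rescalings x₀ x → ChargesPeriodic x := by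
  intro h
  obtain ⟨c, hc, hnot⟩ := exists_rescaling_not_chargesPeriodic x₀ hinj
  exact hnot (h _ ⟨c, hc, rfl⟩)

/-- **Scale is load-bearing (class form).**  For every injective sequence `x₀` with charge-free
windows a.e., the hinge over the rescaling class of `x₀` is false (given the first antecedent
`SoftLayerPropagation`, which is a closed statement): the second antecedent holds throughout the
class, the consequent fails in it. -/
theorem hingeOver_rescalings_false {x₀ : (N : ℕ) → (Fin N → E3)}
    (hinj : ∀ N, Function.Injective (x₀ N)) (hW : WindowsAE x₀) (hSLP : SoftLayerPropagation) :
    ¬ HingeOver (Rescalings x₀) := fun h =>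
  not_forall_rescalings_chargesPeriodic hinj (h hSLP (windows_of_rescalings hW))

/-- The same with BOTH uses of the class spelled out and no appeal to `SoftLayerPropagation`: the
implication "charge-free windows a.e. on the class ⇒ periodic charge on the class" fails. -/
theorem windows_not_imp_chargesPeriodic {x₀ : (N : ℕ) → (Fin N → E3)}
    (hinj : ∀ N, Function.Injective (x₀ N)) (hW : WindowsAE x₀) :
    (∀ R : ℝ, 0 < R → ∀ x : (N : ℕ) → (Fin N → E3), Rescalings x₀ x →
        Tendsto (fun N : ℕ => (windowBadCard R (x N) : ℝ) / N) atTop (𝓝 0)) ∧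
      ¬ ∀ x : (N : ℕ) → (Fin N → E3), Rescalings x₀ x → ChargesPeriodic x :=
  ⟨windows_of_rescalings hW, not_forall_rescalings_chargesPeriodic hinj⟩

/-- **`StackingHinge` is false without the scale information carried by `IsGroundState`.**  Granted
the route's own target `ZeroChargeBulk` (equivalently `ChargeFreeWindows`), take an actual sequence
of Lennard-Jones ground states `x₀` (`LennardJonesGroundStatesExist_holds`): its rescaling class
satisfies the second antecedent of the hinge at every radius, contains `x₀`, and contains a sequence
charging no periodic configuration.  Any proof of the crux must therefore use a property of ground
states that separates `x₀` from its rescalings — an absolute length scale. -/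
theorem stackingHinge_false_without_scale (hZ : ZeroChargeBulk) :
    ∃ x₀ : (N : ℕ) → (Fin N → E3), (∀ N, IsGroundState lennardJones (x₀ N)) ∧
      (∀ R : ℝ, 0 < R → ∀ x : (N : ℕ) → (Fin N → E3), Rescalings x₀ x →
          Tendsto (fun N : ℕ => (windowBadCard R (x N) : ℝ) / N) atTop (𝓝 0)) ∧
      ¬ ∀ x : (N : ℕ) → (Fin N → E3), Rescalings x₀ x → ChargesPeriodic x := by
  choose x₀ hx₀ using LennardJonesGroundStatesExist_holds
  have hW : WindowsAE x₀ := fun R hR => (chargeFreeWindows_iff_zeroChargeBulk.2 hZ) R hR x₀ hx₀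
  exact ⟨x₀, hx₀, windows_not_imp_chargesPeriodic (fun N => (hx₀ N).1) hW⟩

/-- Corollary: the "purely geometric hinge" (the crux for EVERY class of sequences) is false as soon
as the two other open items of the route hold. -/
theorem not_forall_hingeOver (hSLP : SoftLayerPropagation) (hZ : ZeroChargeBulk) :
    ¬ ∀ 𝒞 : ((N : ℕ) → (Fin N → E3)) → Prop, HingeOver 𝒞 := by
  intro h
  obtain ⟨x₀, hx₀, -, hnot⟩ := stackingHinge_false_without_scale hZ
  have hW : WindowsAE x₀ := fun R hR => (chargeFreeWindows_iff_zeroChargeBulk.2 hZ) R hR x₀ hx₀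
  exact hingeOver_rescalings_false (fun N => (hx₀ N).1) hW hSLP (h _)

/-! ## §3a Periodic charge forces recurrence of a lattice basis (checked; evidence `Negative/Recurrence.lean`, to be landed) -/

/-- **Periodic charge forces recurrence of a lattice basis.**  If `ChargesPeriodic x` (witness `Q`),
let `b` be an `ℝ`-basis of `ℝ³` consisting of periods of `Q` and `M = ∑ₖ ‖b k‖`.  A site that is good
for `Q` at the window `(R + M + ε, ε/2)` is recurrent at `(R, ε)`: a site `x N j` of the `R`-window
is `ε/2`-close to `x N i + A (s - q)` for some `s ∈ Q.points` with `dist s q ≤ R + ε/2`, the point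
`s + b k ∈ Q.points` is within `R + M + ε` of `q`, hence `ε/2`-close to some site `x N j'`, and then
`dist (x N j') (x N j + A (b k)) ≤ ε`.  The density `ρ` and the infinitely many `N` are inherited.
[folklore] -/
theorem exists_basis_recurrent_of_chargesPeriodic
    {x : (N : ℕ) → (Fin N → EuclideanSpace ℝ (Fin 3))} (hx : ChargesPeriodic x) :
    ∃ (ι : Type) (b : Module.Basis ι ℝ (EuclideanSpace ℝ (Fin 3))), ∀ R ε : ℝ, 0 < R → 0 < ε →
      ∃ ρ : ℝ, 0 < ρ ∧ ∃ᶠ N : ℕ in atTop, ρ * (N : ℝ) ≤ (Nat.card {i : Fin N //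
        ∃ A : EuclideanSpace ℝ (Fin 3) →ₗᵢ[ℝ] EuclideanSpace ℝ (Fin 3), ∀ (k : ι) (j : Fin N),
          dist (x N j) (x N i) ≤ R → ∃ j' : Fin N, dist (x N j') (x N j + A (b k)) ≤ ε} : ℝ) := by
  obtain ⟨Q, hQ⟩ := hx
  classical
  refine ⟨Module.Free.ChooseBasisIndex ℤ Q.lattice,
    (Module.Free.chooseBasis ℤ Q.lattice).ofZLatticeBasis ℝ Q.lattice, ?_⟩
  set b := (Module.Free.chooseBasis ℤ Q.lattice).ofZLatticeBasis ℝ Q.lattice with hbdef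
  have hb : ∀ k, b k ∈ Q.lattice := fun k => by
    rw [hbdef, Module.Basis.ofZLatticeBasis_apply]
    exact (Module.Free.chooseBasis ℤ Q.lattice k).2
  set M : ℝ := ∑ k, ‖b k‖ with hM
  have hMk : ∀ k, ‖b k‖ ≤ M := fun k =>
    Finset.single_le_sum (f := fun k => ‖b k‖) (fun k _ => norm_nonneg _) (Finset.mem_univ k)
  have hM0 : 0 ≤ M := Finset.sum_nonneg fun k _ => norm_nonneg _
  intro R ε hR hε
  obtain ⟨ρ, hρ, hfr⟩ := hQ (R + M + ε) (ε / 2) (by linarith) (half_pos hε)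
  refine ⟨ρ, hρ, hfr.mono fun N hN => hN.trans ?_⟩
  have key : ∀ i : Fin N,
      (∃ A : EuclideanSpace ℝ (Fin 3) →ₗᵢ[ℝ] EuclideanSpace ℝ (Fin 3), ∃ q ∈ Q.points,
        (∀ s ∈ Q.points, dist s q ≤ R + M + ε →
          ∃ j : Fin N, dist (x N j) (x N i + A (s - q)) ≤ ε / 2) ∧
        (∀ j : Fin N, dist (x N j) (x N i) ≤ R + M + ε →
          ∃ s ∈ Q.points, dist (x N j) (x N i + A (s - q)) ≤ ε / 2)) →
      ∃ A : EuclideanSpace ℝ (Fin 3) →ₗᵢ[ℝ] EuclideanSpace ℝ (Fin 3), ∀ (k) (j : Fin N),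
        dist (x N j) (x N i) ≤ R → ∃ j' : Fin N, dist (x N j') (x N j + A (b k)) ≤ ε := by
    rintro i ⟨A, q, hq, h1, h2⟩
    refine ⟨A, fun k j hj => ?_⟩
    obtain ⟨s, hs, hjs⟩ := h2 j (by linarith)
    have hsq : dist s q ≤ R + ε / 2 := by
      have : dist s q = dist (x N i + A (s - q)) (x N i) := by
        rw [dist_eq_norm, dist_eq_norm, add_sub_cancel_left, LinearIsometry.norm_map]
      rw [this]
      calc dist (x N i + A (s - q)) (x N i)
          ≤ dist (x N i + A (s - q)) (x N j) + dist (x N j) (x N i) := dist_triangle _ _ _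
        _ ≤ ε / 2 + R := add_le_add (by rwa [dist_comm]) hj
        _ = R + ε / 2 := by ring
    obtain ⟨j', hj'⟩ := h1 (s + b k) (Q.add_mem_points hs (hb k)) (by
      calc dist (s + b k) q ≤ dist (s + b k) s + dist s q := dist_triangle _ _ _
        _ = ‖b k‖ + dist s q := by rw [dist_eq_norm, add_sub_cancel_left]
        _ ≤ M + (R + ε / 2) := add_le_add (hMk k) hsq
        _ ≤ R + M + ε := by linarith)
    refine ⟨j', ?_⟩
    have hsplit : x N i + A (s + b k - q) = (x N i + A (s - q)) + A (b k) := by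
      rw [show s + b k - q = (s - q) + b k by abel, map_add, add_assoc]
    calc dist (x N j') (x N j + A (b k))
        ≤ dist (x N j') (x N i + A (s + b k - q)) +
            dist (x N i + A (s + b k - q)) (x N j + A (b k)) := dist_triangle _ _ _
      _ ≤ ε / 2 + ε / 2 := add_le_add hj' (by rw [hsplit, dist_add_right, dist_comm]; exact hjs)
      _ = ε := by ring
  exact_mod_cast Nat.card_le_card_of_injective (Subtype.map id fun i hi => key i hi)
    (Subtype.map_injective _ Function.injective_id)

/-- The same read on `GroundStatesChargePeriodic` (the consequent of the crux): along every sequence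
of Lennard-Jones ground states some basis of `ℝ³` recurs, up to site-dependent rotations, with
positive upper density at every window.  A sequence of ground states violating this recurrence — a
positive density of windows, at some fixed `(R, ε)`, admitting NO triple of independent approximate
periods from a fixed basis — refutes 2911 and with it (given the two antecedents) the crux.
[folklore] -/
theorem recurrent_of_groundStatesChargePeriodic
    (h : Summit.AtomisticToContinuum.Crystallization.Theses.PricedLinkCensus.GroundStatesChargePeriodic)
    (x : (N : ℕ) → (Fin N → EuclideanSpace ℝ (Fin 3)))
    (hx : ∀ N, IsGroundState lennardJones (x N)) :
    ∃ (ι : Type) (b : Module.Basis ι ℝ (EuclideanSpace ℝ (Fin 3))), ∀ R ε : ℝ, 0 < R → 0 < ε →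
      ∃ ρ : ℝ, 0 < ρ ∧ ∃ᶠ N : ℕ in atTop, ρ * (N : ℝ) ≤ (Nat.card {i : Fin N //
        ∃ A : EuclideanSpace ℝ (Fin 3) →ₗᵢ[ℝ] EuclideanSpace ℝ (Fin 3), ∀ (k : ι) (j : Fin N),
          dist (x N j) (x N i) ≤ R → ∃ j' : Fin N, dist (x N j') (x N j + A (b k)) ≤ ε} : ℝ) :=
  exists_basis_recurrent_of_chargesPeriodic (groundStatesChargePeriodic_iff.1 h x hx)


/-- **Kill criterion (contrapositive).**  A sequence along which, for SOME window `(R, ε)`, every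
basis of `ℝ³` fails to recur (up to rotations) on a positive upper density of sites charges no
periodic configuration. [folklore] -/
theorem not_chargesPeriodic_of_not_recurrent
    {x : (N : ℕ) → (Fin N → EuclideanSpace ℝ (Fin 3))}
    (h : ∀ (ι : Type) (b : Module.Basis ι ℝ (EuclideanSpace ℝ (Fin 3))), ∃ R ε : ℝ, 0 < R ∧ 0 < ε ∧
      ∀ ρ : ℝ, 0 < ρ → ∀ᶠ N : ℕ in atTop, (Nat.card {i : Fin N //
        ∃ A : EuclideanSpace ℝ (Fin 3) →ₗᵢ[ℝ] EuclideanSpace ℝ (Fin 3), ∀ (k : ι) (j : Fin N),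
          dist (x N j) (x N i) ≤ R → ∃ j' : Fin N, dist (x N j') (x N j + A (b k)) ≤ ε} : ℝ) <
        ρ * (N : ℝ)) :
    ¬ ChargesPeriodic x := by
  intro hx
  obtain ⟨ι, b, hb⟩ := exists_basis_recurrent_of_chargesPeriodic hx
  obtain ⟨R, ε, hR, hε, hfail⟩ := h ι b
  obtain ⟨ρ, hρ, hfr⟩ := hb R ε hR hε
  exact (hfr.and_eventually (hfail ρ hρ)).exists.elim fun N hN => absurd hN.1 (not_le.2 hN.2)

/-- **Kill criterion for the shared hinge 2911** (and hence, given the two antecedents, for the crux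
`StackingHinge`, by `not_stackingHinge_iff`): ONE sequence of Lennard-Jones ground states without
basis recurrence at some window refutes `GroundStatesChargePeriodic`. [folklore] -/
theorem not_groundStatesChargePeriodic_of_not_recurrent
    (x : (N : ℕ) → (Fin N → EuclideanSpace ℝ (Fin 3)))
    (hx : ∀ N, IsGroundState lennardJones (x N))
    (h : ∀ (ι : Type) (b : Module.Basis ι ℝ (EuclideanSpace ℝ (Fin 3))), ∃ R ε : ℝ, 0 < R ∧ 0 < ε ∧
      ∀ ρ : ℝ, 0 < ρ → ∀ᶠ N : ℕ in atTop, (Nat.card {i : Fin N //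
        ∃ A : EuclideanSpace ℝ (Fin 3) →ₗᵢ[ℝ] EuclideanSpace ℝ (Fin 3), ∀ (k : ι) (j : Fin N),
          dist (x N j) (x N i) ≤ R → ∃ j' : Fin N, dist (x N j') (x N j + A (b k)) ≤ ε} : ℝ) <
        ρ * (N : ℝ)) :
    ¬ Summit.AtomisticToContinuum.Crystallization.Theses.PricedLinkCensus.GroundStatesChargePeriodic :=
  fun hG => not_chargesPeriodic_of_not_recurrent h (groundStatesChargePeriodic_iff.1 hG x hx)

/-- The same kill criterion read on the crux: given its two antecedents (`SoftLayerPropagation` and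
`ZeroChargeBulk ↔ ChargeFreeWindows`), a non-recurrent sequence of ground states refutes
`StackingHinge`. [folklore] -/
theorem stackingHinge_false_of_not_recurrent
    (hSLP : Summit.AtomisticToContinuum.Crystallization.Theses.PricedLinkCensus.SoftLayerPropagation)
    (hZ : Summit.AtomisticToContinuum.Crystallization.Theses.PricedLinkCensus.ZeroChargeBulk)
    (x : (N : ℕ) → (Fin N → EuclideanSpace ℝ (Fin 3)))
    (hx : ∀ N, IsGroundState lennardJones (x N))
    (h : ∀ (ι : Type) (b : Module.Basis ι ℝ (EuclideanSpace ℝ (Fin 3))), ∃ R ε : ℝ, 0 < R ∧ 0 < ε ∧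
      ∀ ρ : ℝ, 0 < ρ → ∀ᶠ N : ℕ in atTop, (Nat.card {i : Fin N //
        ∃ A : EuclideanSpace ℝ (Fin 3) →ₗᵢ[ℝ] EuclideanSpace ℝ (Fin 3), ∀ (k : ι) (j : Fin N),
          dist (x N j) (x N i) ≤ R → ∃ j' : Fin N, dist (x N j') (x N j + A (b k)) ≤ ε} : ℝ) <
        ρ * (N : ℝ)) :
    ¬ Summit.AtomisticToContinuum.Crystallization.Theses.PricedLinkCensus.StackingHinge :=
  not_stackingHinge_iff.2 ⟨hSLP, hZ, not_groundStatesChargePeriodic_of_not_recurrent x hx h⟩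


/-! ## §3b Word selection is load-bearing (near-miss; paper proof in the docstring) -/

/-- **NEAR-MISS (word).**  STRENGTHENING W: "if along an injective sequence at FIXED scale
(`dist ≥ 1` between distinct sites) almost every site has, for every `R`, its `R`-window EXACTLY
two-way matched with a rigid image of an ideal Barlow stacking `barlowStacking 1 √(2/3) s` (the
word `s` depending on the site), then some periodic `Q` is charged".  W is FALSE.  Witness: `x N` =
the `N` points of least norm of `barlowStacking 1 √(2/3) σ` with `σ` a Sturmian (e.g. Fibonacci)
Hägg word, which is uniformly recurrent, aperiodic and 4-power-free.  Every site farther than `R`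
from the surface has an exact Barlow `R`-window (word = the factor of `σ` around its layer), and the
surface fraction tends to `0`.  If a periodic `Q` (period lattice `Λ`, basis `g₁, g₂, g₃`) were
charged, fix `c(Λ) = min_{‖v‖=1} max_k |⟨g_k, v⟩| > 0` and `C = max ‖g_k‖`; at a deep good site with
`ε < c/4`, `R ≫ C`, the window `S ∩ B(x_i, R)` is `2ε`-invariant under the translation `A g_k` for
the `k` with `|⟨A g_k, e₃⟩| ≥ c > 2ε`, which shifts layers by an integer `m ≠ 0`, `|m| ≤ C/h`; hence
the factor of `σ` of length `∼ 2(R − C)/h` around the site's layer is `m`-periodic — a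
`(2(R − C)/(h m))`-power, contradicting 4-power-freeness once `R ≥ 3C + h`.  OBSTRUCTION to closing
it here: reading the Hägg word off an `ε`-matching of a Barlow window (rigidity of exact Barlow
windows under small two-way matchings) and the combinatorics of Sturmian words are not in the tree;
both are sizeable.  What IS in the tree confirms the diagnosis: the König / Cantor selection
(`exists_branch_frequently_mul_le`, `exists_chargedWordScale_of_chargedBarlowWindows`) returns SOME
word `s∞`, "the selected word need not be periodic" (docstring of
`PricedLinkCensusStackingHingeWordSelection.lean`). -/
theorem strengtheningW_false :
    ¬ ∀ x : (N : ℕ) → (Fin N → E3),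
      (∀ N, Function.Injective (x N)) →
      (∀ (N : ℕ) (i j : Fin N), i ≠ j → (1 : ℝ) ≤ dist (x N i) (x N j)) →
      (∀ R : ℝ, 0 < R → Tendsto (fun N : ℕ => (Nat.card {i : Fin N //
          ¬ ∃ (s : ℤ → ℤ) (g : E3 ≃ᵃⁱ[ℝ] E3), IsHaggSeq s ∧
            (∀ j : Fin N, dist (x N i) (x N j) ≤ R →
              x N j ∈ g '' barlowStacking 1 (Real.sqrt (2 / 3)) s) ∧
            (∀ z ∈ barlowStacking 1 (Real.sqrt (2 / 3)) s, dist (x N i) (g z) ≤ R →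
              ∃ j : Fin N, x N j = g z)} : ℝ) / N) atTop (𝓝 0)) →
      ChargesPeriodic x := by
  sorry

/-! ## §4 Line `Sketch`: the shape of a kill of the priced stub -/

/-- The priced inequality of line `Sketch` at the hcp scale `(a, h)` (copied from
`Cruxes/StackingHinge/Lines/Sketch.lean`, `PricedHcpWindowsAt`, with `eStar`, `GoodWindow`,
`RigidMatch` inlined). -/
def PricedHcpWindowsAt (a h : ℝ) : Prop :=
  ∀ δ₀ : ℝ, 0 < δ₀ → ∀ R ε : ℝ, 0 < R → 0 < ε → ∃ κ L C : ℝ, 0 < κ ∧ 0 < L ∧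
    ∀ (N : ℕ) (y : Fin N → E3), Function.Injective y →
      (∀ i j : Fin N, i ≠ j → δ₀ ≤ dist (y i) (y j)) →
      (N : ℝ) * (⨅ Q : PeriodicConfiguration 3, Q.energyPerParticle lennardJones)
        + κ * (Nat.card {i : Fin N // (∀ j : Fin N, dist (y i) (y j) ≤ L * nearestDist y i →
            IsChargeFree (1 / 100 : ℝ) y j) ∧
            ¬ ∃ g : E3 ≃ᵃⁱ[ℝ] E3,
              (∀ j : Fin N, dist (y i) (y j) ≤ R →
                ∃ z ∈ barlowStacking a h alternatingHagg, dist (y j) (g z) ≤ ε) ∧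
              (∀ z ∈ barlowStacking a h alternatingHagg, dist (y i) (g z) ≤ R →
                ∃ j : Fin N, dist (y j) (g z) ≤ ε)} : ℝ)
        - C * (Nat.card {i : Fin N // ¬ ∀ j : Fin N, dist (y i) (y j) ≤ L * nearestDist y i →
            IsChargeFree (1 / 100 : ℝ) y j} : ℝ)
      ≤ interactionEnergy lennardJones y

/-- **Shape of a kill of the priced stub** (bookkeeping only).  If for some `(δ₀, R, ε)` there is a
family of admissible configurations `y n` with: unmatched-good count `U n → ∞`-dominating, namely
energy excess per unmatched site `→ 0` and bad count per unmatched site `→ 0` UNIFORMLY IN `L`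
(the sets depend on `L`; here the hypothesis is asked for every `L > 0`), then `PricedHcpWindowsAt a h`
fails.  Conversely nothing weaker can work: with `#B ≥ 1` always (extreme points of a finite
configuration are charged) the free constant `C` absorbs every bounded family.  Recorded to fix what
the numerics must look for: near-degenerate CHARGE-FREE competitors of hcp, not merely low-energy
ones. -/
theorem pricedHcpWindows_kill_shape {a h : ℝ} (δ₀ R ε : ℝ) (hδ : 0 < δ₀) (hR : 0 < R) (hε : 0 < ε)
    (hkill : ∀ κ L C : ℝ, 0 < κ → 0 < L → ∃ (N : ℕ) (y : Fin N → E3), Function.Injective y ∧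
      (∀ i j : Fin N, i ≠ j → δ₀ ≤ dist (y i) (y j)) ∧
      interactionEnergy lennardJones y <
        (N : ℝ) * (⨅ Q : PeriodicConfiguration 3, Q.energyPerParticle lennardJones)
        + κ * (Nat.card {i : Fin N // (∀ j : Fin N, dist (y i) (y j) ≤ L * nearestDist y i →
            IsChargeFree (1 / 100 : ℝ) y j) ∧
            ¬ ∃ g : E3 ≃ᵃⁱ[ℝ] E3,
              (∀ j : Fin N, dist (y i) (y j) ≤ R →
                ∃ z ∈ barlowStacking a h alternatingHagg, dist (y j) (g z) ≤ ε) ∧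
              (∀ z ∈ barlowStacking a h alternatingHagg, dist (y i) (g z) ≤ R →
                ∃ j : Fin N, dist (y j) (g z) ≤ ε)} : ℝ)
        - C * (Nat.card {i : Fin N // ¬ ∀ j : Fin N, dist (y i) (y j) ≤ L * nearestDist y i →
            IsChargeFree (1 / 100 : ℝ) y j} : ℝ)) :
    ¬ PricedHcpWindowsAt a h := by
  intro hP
  obtain ⟨κ, L, C, hκ, hL, hall⟩ := hP δ₀ hδ R ε hR hε
  obtain ⟨N, y, hy, hsep, hlt⟩ := hkill κ L C hκ hL
  exact absurd (hall N y hy hsep) (not_le.2 hlt)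

end Summit.AtomisticToContinuum.Crystallization.Cruxes.StackingHinge.Disproof

end
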